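/-
Copyright (c) 2026 the pub-hodgecm-mathlib formalisation cell (harness21).  Prover seat hodgecm-mathlib-K2Liu-p14 (g3), Track B «K2-LIT»,
#184♮ = hLiu418 = `stmt-HodgeConjecture-24832`; Road I v3, S5-F3 lineage ∕ I4-conv (F′-fact), E-3b: THE EULER IDENTITY OF THE INNER SECTION OF TERM 2.
-/
import Summits.HodgeConjecture.HodgeConjecture.Theorems.K2LiuKlingenTermTwoTensor              -- ★ E-3a: `exists_tensor`, `integrand_eq_tensor_mul_finprod` (+ ★ E-1 `local_factor_eq_one`, ★ hK, ★ B∕B2)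
import Summits.HodgeConjecture.HodgeConjecture.Theorems.K2LiuKlingenFibreEulerNatural           -- ★ E-D0: `exists_natural_integral_eq_mul_tprod`
import Summits.HodgeConjecture.HodgeConjecture.Theorems.K2LiuKlingenInnerSectionFactorizable    -- ★ E-2: `innerSection_eq_mul_tprod_mul_finprod`
import Summits.HodgeConjecture.HodgeConjecture.Theorems.K2LiuKlingenInnerSectionSpherical       -- ★ C (F0P2-p10): `apply_eq_apply_one_mul_lambdaLoc_localCongr` (+ ★ dictionary, ★ `exists_isSiegelIntDecomp`, ★ `bridge_congr`)
import HarnessLib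

/-!
# Crux `HLiu418`, I4-conv (F′-fact), E-3b — `K2LiuKlingenInnerSectionEulerIdentity`: THE EULER IDENTITY OF THE INNER SECTION OF TERM 2
# `F′_{h,f_s}(g₂) = (∫ gN_s(g₂) dμ) · (∏'_{v∉T′} J_{s,v}(1)) · ∏ᶠ_{v∉T′} Λ^{line}_{s−½,v}(Ψ_{S,v}((g₂)_v))`

Cell `hodgecm-mathlib`, crux item hLiu418 = `stmt-HodgeConjecture-24832`; squad K2 ∕ K2Liu; LEAD F0P6-plan (g14) BATCH #36 (E = K2Liu-p14 (g3)).  THEOREMS ONLY (no `def`,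
no instance, no notation, no named-fact hypothesis, no `sorry`); lane `--supports stmt-HodgeConjecture-24832 --as helper` (count-neutral).

THE POINT (the organ I4-conv assembled).  For the term-2 inner section `F′_{h,f_s}(g₂) = ∫_{Y(𝔸)×𝔸_L} f_s(Ψ(ξ)Ψ(n_Q(y,0,t))Ψ(m_Q(1,j₂⁻¹g₂))h) d(μ_Y ⊗ μ_T)` of a family `f`
★ #31s-factorizable off `T′` (`T′ ⊇` the places above `2`, the ramification of `χ`, the non-units of `δ`, the places where `h_v ∉ K_{H,v}` or `Ψ_v(U(J₄)(𝒪_v)) ⊄ K_{H,v}`):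
`∃ μ gN` (★ E-D0's `T′`-measure, ★ E-3a's `T′`-tensor — ONE pair for all `s`, `g₂`) with `gN s g₂` depending on `g₂` only through `(archPart g₂, ((g₂)_v)_{v∈T′})`, such
that for every `s` at which the local inner functionals `J_{s,v} = innerSectionLoc v (ν_{Y,v}) (ν_{T,v}) (psiLoc Ψ v) (Λ_{s,v}) h_v` carry ★ C's local Borel law (`hlaw`, BY
VALUE — paid by ★ `hlaw_of_upper_mul` ∘ ★ `innerSectionLoc_upper_mul_units` ∘ ★ `K2LiuLocalRingHaarModulus` at the local frame readings) and every `g₂` with integrable integrand: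
`F′_{h,f_s}(g₂) = (∫ gN s g₂ ∘ R dμ) · (∏'_{v∉T′} J_{s,v}(1)) · ∏ᶠ_{v∉T′} Λ^{line}_{s−½,v}(Ψ_{S,v}((g₂)_v))`, `Ψ_{S,v} = ★ «D5» UnitaryGroup.localCongr … S … v`.
PROOF.  ★ E-D0 (`hF` := ★ E-3a `integrand_eq_tensor_mul_finprod`, `hφN` := ★ E-1 `local_factor_eq_one` off the finite set of places where `(g₂)_v ∉ U(J₂)(𝒪_v)`,
★ `eventually_evalPlace_mem_localInt`) ⇒ `F′ = I · ∏'_v J_{s,v}((g₂)_v)` and, unless the `T′`-tensor is a.e. zero (then both sides vanish), `Multipliable (J_{s,v}((g₂)_v))_v`;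
★ C §5 (`hK` := ★ `innerSectionLoc_lambdaLoc_mul_localInt`, `hlaw`) ⇒ `J_{s,v} = J_{s,v}(1) · Λ^{line}_{s−½,v} ∘ Ψ_{S,v}`; `Λ^{line} ≠ 0` at good places (§1, ★ `exists_isSiegelIntDecomp`)
⇒ `Multipliable (J_{s,v}(1))_v`; ★ E-2 `innerSection_eq_mul_tprod_mul_finprod` assembles.
* §1 `mem_integer_of_mem_adicCompletionIntegers` (the two integer spellings), `lambdaLoc_line_ne_zero` (`Λ^{line}_{σ,v}(x) ≠ 0` at a good place).
* §2 **`exists_innerSection_euler`** — THE HEAD (statement above; currency of ★ E-3a: `Ψ : U(J₄)(𝔸) →* H(𝔸)` pinned by `SA`, ★ B's `hΨ`).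
[CasselsFrohlichANT1967, Ch. XV (Tate) §3.3 Thm. 3.3.1], [MoeglinWaldspurger1995, II.1.7], [Liu2011, §2B p. 862], [Casselman1980, §3], [Li1992, §3], [Tan1999, §1–§2].
HONEST LABEL.  Count-neutral helper, closes no socket: `HC_CM` is proved only modulo the 7 printed citations (2 remaining named inputs: hLiu418 =
`stmt-HodgeConjecture-24832`, h413 = `stmt-HodgeConjecture-24833`) until rung 0 closes.
-/

set_option autoImplicit false
set_option linter.dupNamespace false -- the mandated namespace repeats `HodgeConjecture.HodgeConjecture`

noncomputable section

open scoped Matrix ENNReal NNReal Topology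
open NumberField IsDedekindDomain MeasureTheory Measure Filter Set

namespace Summit.HodgeConjecture.HodgeConjecture.Cruxes.HLiu418.K2LiuKlingenInnerSectionEulerIdentity

open Literature.NumberTheory.Automorphic Literature.NumberTheory.Automorphic.UnitaryGroup
open Literature.NumberTheory.GelbartRogawski1991 Literature.NumberTheory.GelbartRogawski1991.GRConstruction
open Literature.NumberTheory.GaloisRepresentations
open Literature.NumberTheory.K2Lit.SiegelDoubled Literature.NumberTheory.K2Lit.LocalSiegelDoubled
open Summit.HodgeConjecture.HodgeConjecture.Cruxes.HLiu418.K2LiuKlingenParabolicDefs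
open Summit.HodgeConjecture.HodgeConjecture.Cruxes.HLiu418.K2LiuKlingenUnipotentAdelicDefs
open Summit.HodgeConjecture.HodgeConjecture.Cruxes.HLiu418.K2LiuSiegelDoubledLeviMatrix (conjAdele_conjAdele')
open Summit.HodgeConjecture.HodgeConjecture.Cruxes.HLiu418.K2LiuKlingenInnerSectionLocalDefs
open Summit.HodgeConjecture.HodgeConjecture.Cruxes.HLiu418.K2LiuKlingenInnerSectionLocalInvariance (innerSectionLoc_lambdaLoc_mul_localInt)
open Summit.HodgeConjecture.HodgeConjecture.Cruxes.HLiu418.K2LiuKlingenInnerSectionShape (local_factor_eq_one)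
open Summit.HodgeConjecture.HodgeConjecture.Cruxes.HLiu418.K2LiuKlingenTermTwoTensor
open Summit.HodgeConjecture.HodgeConjecture.Cruxes.HLiu418.K2LiuKlingenFibreEulerNatural (exists_natural_integral_eq_mul_tprod)
open Summit.HodgeConjecture.HodgeConjecture.Cruxes.HLiu418.K2LiuKlingenInnerSectionFactorizable (innerSection_eq_mul_tprod_mul_finprod)
open Summit.HodgeConjecture.HodgeConjecture.Cruxes.HLiu418.K2LiuKlingenInnerSectionSpherical (apply_eq_apply_one_mul_lambdaLoc_localCongr valuation_gramR_one_le)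
open Summit.HodgeConjecture.HodgeConjecture.Cruxes.HLiu418.K2LiuSphericalSectionLambdaLoc (exists_isSiegelIntDecomp)
open Summit.HodgeConjecture.HodgeConjecture.Cruxes.HLiu418.K2LiuLineBridgeLocalDictionary (formCongr_bridge symm_apply_mem_localInt_iff localCongr_apply_eq_conj)

variable (L : Type) [Field L] [NumberField L] [IsCMField L]

/-! ## §1 Two small letters -/

omit [IsCMField L] in
/-- the two integer spellings of `L_w` agree: `x ∈ 𝒪_w` (Mathlib `adicCompletionIntegers`, `Valued.v x ≤ 1`) gives `x ∈ (ValuativeRel.valuation L_w).integer`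
(Mathlib `Valuation.vle_one_iff`). [cite: SerreLocalFields1979, Ch. II §1] -/
theorem mem_integer_of_mem_adicCompletionIntegers (w : HeightOneSpectrum (𝓞 L)) {x : w.adicCompletion L} (hx : x ∈ w.adicCompletionIntegers L) :
    x ∈ (ValuativeRel.valuation (w.adicCompletion L)).integer := by
  rw [Valuation.mem_integer_iff, ← Valuation.vle_one_iff (ValuativeRel.valuation (w.adicCompletion L)),
    Valuation.vle_one_iff (Valued.v : Valuation (w.adicCompletion L) (WithZero (Multiplicative ℤ)))]
  exact (HeightOneSpectrum.mem_adicCompletionIntegers ..).1 hx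

/-- **`Λ^{line}_{σ,v}(x) ≠ 0` at a good place** (`|2|_w = 1`, `χ` unramified above `v`): every `x ∈ H₁(L⁺_v)` is `p k` (★ `exists_isSiegelIntDecomp` on the line frame, whose
integrality binders are ★ `valuation_gramR_one_le`), and `Λ(p k) = siegelCharLoc(p) = χ(det_Δ) · |det_Δ|^{…} ≠ 0` (★ `lambdaLoc_mul_eq`, ★ `modDelta_pos`). [cite: Li1992, §3]
[cite: Casselman1980, §3] -/
theorem lambdaLoc_line_ne_zero (v : HeightOneSpectrum (𝓞 (Fp L))) (χ : HeckeCharacter L) (σ : ℂ) (hχ : ∀ w : PlacesOver L v, χ.IsUnramifiedAt w.1)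
    (h2 : ∀ w : PlacesOver L v, ValuativeRel.valuation (w.1.adicCompletion L) (2 : w.1.adicCompletion L) = 1)
    (x : localPi L (IsCMField.complexConj L) (1 + 1) (hermD L (Equiv.prodUnique (Fin 1) (Fin 1)) (fun _ => (1 : L)) (fun _ => map_one _) (fun _ => (1 : L)) (fun _ => map_one _)) v) :
    LambdaLoc L (Equiv.prodUnique (Fin 1) (Fin 1)) (fun _ => (1 : L)) (fun _ => map_one _) (fun _ => (1 : L)) (fun _ => map_one _) v χ σ x ≠ 0 := by
  obtain ⟨⟨p, k⟩, hp, hk, rfl⟩ := exists_isSiegelIntDecomp L (Equiv.prodUnique (Fin 1) (Fin 1)) (fun _ => (1 : L)) (fun _ => map_one _) (fun _ => (1 : L))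
    (fun _ => map_one _) v (fun _ => one_ne_zero) (fun _ => one_ne_zero) h2 (fun w i j => (valuation_gramR_one_le L v w i j).1)
    (fun w i j => (valuation_gramR_one_le L v w i j).2) x
  rw [lambdaLoc_mul_eq L _ _ _ _ _ v χ σ hχ hp hk, siegelCharLoc_apply, siegelDeltaCharacter]
  exact mul_ne_zero (Units.ne_zero _) fun h0 => (Complex.ofReal_ne_zero.2 (modDelta_pos L _ _ _ _ _ _).ne') ((Complex.cpow_eq_zero_iff _ _).1 h0).1

/-! ## §2 The Euler identity -/

section Euler

variable {N M : ℕ} {e : Fin N × Fin M ≃ Fin 2}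
  {dV : Fin N → L} {hdV : ∀ i, IsCMField.complexConj L (dV i) = dV i}
  {dW : Fin M → L} {hdW : ∀ i, IsCMField.complexConj L (dW i) = dW i}

set_option maxHeartbeats 800000 in -- MEASURED (fails 400000): the statement alone (two `(2+2)`∕`4` currencies, `1+1`∕`2` on the line, ★ B `innerSectionLoc` over `psiLoc`) exceeds 200000 at `whnf`
/-- **THE EULER IDENTITY OF THE INNER SECTION OF TERM 2** (statement and proof in the header).  Binders: the measurable structures and the Klingen-fibre measures
of ★ E-D0 (`hσδ hδ Y hY μY μT T′ νY νT h2 hδv hν1`); the transport `Ψ` pinned by `SA` (★ B's `hΨ`) with `Ψ_v(U(J₄)(𝒪_v)) ≤ K_{H,v}` off `T′` (`hΨK`); `χ` unramified off `T′`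
(`hχ`), `|2|_w = 1` off `T′` (`h2w`); the family `f` ★ #31s-factorizable off `T′` (`hfac`); `h ∈ H(𝔸)` integral off `T′` (`hh`); the line bridge matrix `S` (`hS`, `hS'`).
Per `(s, g₂)`: integrability of the integrand (`hFi`) and ★ C's local Borel law of the `J_{s,v}` (`hlaw`, BY VALUE).
[cite: CasselsFrohlichANT1967, Ch. XV (Tate) §3.3 Thm. 3.3.1] [cite: MoeglinWaldspurger1995, II.1.7] [cite: Liu2011, §2B p. 862] [cite: Casselman1980, §3] -/
theorem exists_innerSection_euler
    [MeasurableSpace (AdeleRing (𝓞 L) L)] [BorelSpace (AdeleRing (𝓞 L) L)]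
    [MeasurableSpace (InfiniteAdeleRing (Fp L))] [BorelSpace (InfiniteAdeleRing (Fp L))]
    [∀ v : HeightOneSpectrum (𝓞 (Fp L)), MeasurableSpace (v.adicCompletion (Fp L))] [∀ v : HeightOneSpectrum (𝓞 (Fp L)), BorelSpace (v.adicCompletion (Fp L))]
    [∀ v : HeightOneSpectrum (𝓞 (Fp L)), MeasurableSpace (LocalRing L v)] [∀ v : HeightOneSpectrum (𝓞 (Fp L)), BorelSpace (LocalRing L v)]
    {δ : L} (hσδ : IsCMField.complexConj L δ = -δ) (hδ : δ ≠ 0)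
    (Y : AddSubgroup (AdeleRing (𝓞 L) L)) (hY : ∀ y, y ∈ Y ↔ conjAdele (Fp L) L (IsCMField.complexConj L) y = -y)
    (μY : Measure ↥Y) (μT : Measure (AdeleRing (𝓞 L) L)) [μY.IsAddHaarMeasure] [μT.IsAddHaarMeasure]
    (T' : Finset (HeightOneSpectrum (𝓞 (Fp L))))
    (νY : ∀ v : HeightOneSpectrum (𝓞 (Fp L)), Measure ↥(skewLoc L v)) (νT : ∀ v : HeightOneSpectrum (𝓞 (Fp L)), Measure (LocalRing L v))
    [∀ v, ((νY v).prod (νT v)).IsAddHaarMeasure]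
    (h2 : ∀ v, v ∉ T' → Valued.v ((2 : Fp L) : v.adicCompletion (Fp L)) = 1)
    (h2w : ∀ v, v ∉ T' → ∀ w : PlacesOver L v, ValuativeRel.valuation (w.1.adicCompletion L) (2 : w.1.adicCompletion L) = 1)
    (hδv : ∀ v, v ∉ T' → ∀ w : PlacesOver L v, Valued.v (algebraMap L (w.1.adicCompletion L) δ) = 1)
    (hν1 : ∀ v, v ∉ T' → ((νY v).prod (νT v))
      {q : ↥(skewLoc L v) × LocalRing L v | (∀ w : PlacesOver L v, (q.1 : LocalRing L v) w ∈ w.1.adicCompletionIntegers L) ∧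
        ∀ w : PlacesOver L v, q.2 w ∈ w.1.adicCompletionIntegers L} = 1)
    (Ψ : (adelicGroupData (Fp L) L (IsCMField.complexConj L) 4 ((StdForm.antidiagonal 4).over L)).Adelic →* HA L e dV hdV dW hdW)
    (SA : GL (Fin 4) (AdeleRing (𝓞 L) L))
    (hΨ : ∀ g : (adelicGroupData (Fp L) L (IsCMField.complexConj L) 4 ((StdForm.antidiagonal 4).over L)).Adelic,
      (((Ψ g).1 : GL (Fin 4) (AdeleRing (𝓞 L) L)) : Matrix (Fin 4) (Fin 4) (AdeleRing (𝓞 L) L)) =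
        (SA : Matrix (Fin 4) (Fin 4) (AdeleRing (𝓞 L) L)) *
          ((adelicVal (Fp L) L (IsCMField.complexConj L) 4 ((StdForm.antidiagonal 4).over L) g : GL (Fin 4) (AdeleRing (𝓞 L) L)) :
            Matrix (Fin 4) (Fin 4) (AdeleRing (𝓞 L) L)) *
          ((SA⁻¹ : GL (Fin 4) (AdeleRing (𝓞 L) L)) : Matrix (Fin 4) (Fin 4) (AdeleRing (𝓞 L) L)))
    (hΨK : ∀ v, v ∉ T' → ∀ k ∈ localInt L (IsCMField.complexConj L) 4 ((StdForm.antidiagonal 4).over L) v,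
      psiLoc L Ψ v k ∈ localInt L (IsCMField.complexConj L) (2 + 2) (hermD L e dV hdV dW hdW) v)
    (χ : HeckeCharacter L) (hχ : ∀ v, v ∉ T' → ∀ w : PlacesOver L v, χ.IsUnramifiedAt w.1)
    (f : ℂ → HA L e dV hdV dW hdW → ℂ)
    (fT : ℂ → arch (Fp L) L (IsCMField.complexConj L) (2 + 2) (hermD L e dV hdV dW hdW) ×
      (Π v : T', localPi L (IsCMField.complexConj L) (2 + 2) (hermD L e dV hdV dW hdW) v.1) → ℂ)
    (hfac : IsFactorizableOff L e dV hdV dW hdW T' χ f fT) (h : HA L e dV hdV dW hdW)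
    (hh : ∀ v, v ∉ T' → evalPlace (Fp L) L (IsCMField.complexConj L) (2 + 2) (hermD L e dV hdV dW hdW) v
      (finPart (Fp L) L (IsCMField.complexConj L) (2 + 2) (hermD L e dV hdV dW hdW) h) ∈ localInt L (IsCMField.complexConj L) (2 + 2) (hermD L e dV hdV dW hdW) v)
    (S : GL (Fin 2) L) (hS : (S : Matrix (Fin 2) (Fin 2) L) = !![1, 2⁻¹; 1, -2⁻¹]) (hS' : ((S⁻¹ : GL (Fin 2) L) : Matrix (Fin 2) (Fin 2) L) = !![2⁻¹, 2⁻¹; 1, -1]) :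
    haveI : Algebra.IsQuadraticExtension (Fp L) L := IsCMField.isQuadraticExtension L
    ∃ (μ : Measure ((Fin 3 → InfiniteAdeleRing (Fp L)) × (Π v : T', Fin 3 → v.1.adicCompletion (Fp L))))
      (gN : ℂ → (quasiSplit (Fp L) L (IsCMField.complexConj L) 2).Adelic →
        (InfiniteAdeleRing L × InfiniteAdeleRing L) × (Π v : T', Fin 3 → v.1.adicCompletion (Fp L)) → ℂ),
      μ.IsAddHaarMeasure ∧ SigmaFinite μ ∧
      (∀ (s : ℂ) (g₂ g₂' : (quasiSplit (Fp L) L (IsCMField.complexConj L) 2).Adelic),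
        archPart (Fp L) L (IsCMField.complexConj L) 2 ((StdForm.antidiagonal 2).over L) g₂ = archPart (Fp L) L (IsCMField.complexConj L) 2 ((StdForm.antidiagonal 2).over L) g₂' →
        (∀ v : T', evalPlace (Fp L) L (IsCMField.complexConj L) 2 ((StdForm.antidiagonal 2).over L) v.1 (finPart (Fp L) L (IsCMField.complexConj L) 2 ((StdForm.antidiagonal 2).over L) g₂) =
          evalPlace (Fp L) L (IsCMField.complexConj L) 2 ((StdForm.antidiagonal 2).over L) v.1 (finPart (Fp L) L (IsCMField.complexConj L) 2 ((StdForm.antidiagonal 2).over L) g₂')) →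
        gN s g₂ = gN s g₂') ∧
      ∀ (s : ℂ) (g₂ : (quasiSplit (Fp L) L (IsCMField.complexConj L) 2).Adelic),
        Integrable (fun q : ↥Y × AdeleRing (𝓞 L) L =>
          f s (Ψ (jAdelic L 4 (weylXi (AdeleRing (𝓞 L) L) (conjAdele (Fp L) L (IsCMField.complexConj L)))) *
            Ψ (jAdelic L 4 (nKlingen (AdeleRing (𝓞 L) L) (conjAdele (Fp L) L (IsCMField.complexConj L)) (conjAdele_conjAdele' L)
              (((q.1 : ↥Y) : AdeleRing (𝓞 L) L)) ((hY _).1 q.1.2) 0 q.2)) *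
            (Ψ (jAdelic L 4 (klingenLevi (AdeleRing (𝓞 L) L) (conjAdele (Fp L) L (IsCMField.complexConj L)) (conjAdele_conjAdele' L) 1 ((jAdelic L 2).symm g₂))) * h))) (μY.prod μT) →
        -- ★ C's local Borel law of `J_{s,v}` at every `v ∉ T′` (BY VALUE; paid by ★ `hlaw_of_upper_mul` ∘ ★ `innerSectionLoc_upper_mul_units`)
        (∀ v, v ∉ T' → ∀ (b g : localPi L (IsCMField.complexConj L) 2 ((StdForm.antidiagonal 2).over L) v) (u : ∀ w : PlacesOver L v, (w.1.adicCompletion L)ˣ),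
          (∀ w : PlacesOver L v, (((b : LocalGLPi L 2 v) w : GL (Fin 2) (w.1.adicCompletion L)) : Matrix (Fin 2) (Fin 2) (w.1.adicCompletion L)) 1 0 = 0) →
          (∀ w : PlacesOver L v, (u w : w.1.adicCompletion L) =
            (((b : LocalGLPi L 2 v) w : GL (Fin 2) (w.1.adicCompletion L)) : Matrix (Fin 2) (Fin 2) (w.1.adicCompletion L)) 0 0) →
            innerSectionLoc L v (νY v) (νT v) (psiLoc L Ψ v) (LambdaLoc L e dV hdV dW hdW v χ s)
                (evalPlace (Fp L) L (IsCMField.complexConj L) (2 + 2) (hermD L e dV hdV dW hdW) v (finPart (Fp L) L (IsCMField.complexConj L) (2 + 2) (hermD L e dV hdV dW hdW) h))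
                (b * g) =
              (∏ w : PlacesOver L v, ((χ.localComponent w.1 (u w) : ℂˣ) : ℂ)) *
                (((∏ w : PlacesOver L v, ‖(u w : w.1.adicCompletion L)‖ : ℝ) : ℂ) ^ (s - 1 / 2 + 1 / 2)) *
                innerSectionLoc L v (νY v) (νT v) (psiLoc L Ψ v) (LambdaLoc L e dV hdV dW hdW v χ s)
                  (evalPlace (Fp L) L (IsCMField.complexConj L) (2 + 2) (hermD L e dV hdV dW hdW) v (finPart (Fp L) L (IsCMField.complexConj L) (2 + 2) (hermD L e dV hdV dW hdW) h)) g) →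
        ∫ q : ↥Y × AdeleRing (𝓞 L) L,
            f s (Ψ (jAdelic L 4 (weylXi (AdeleRing (𝓞 L) L) (conjAdele (Fp L) L (IsCMField.complexConj L)))) *
              Ψ (jAdelic L 4 (nKlingen (AdeleRing (𝓞 L) L) (conjAdele (Fp L) L (IsCMField.complexConj L)) (conjAdele_conjAdele' L)
                (((q.1 : ↥Y) : AdeleRing (𝓞 L) L)) ((hY _).1 q.1.2) 0 q.2)) *
              (Ψ (jAdelic L 4 (klingenLevi (AdeleRing (𝓞 L) L) (conjAdele (Fp L) L (IsCMField.complexConj L)) (conjAdele_conjAdele' L) 1 ((jAdelic L 2).symm g₂))) * h)) ∂(μY.prod μT) =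
          (∫ x, gN s g₂ ((quadraticInfiniteAdeleEquiv (Fp L) L (not_mem_range_algebraMap_of_apply_eq_neg L (IsCMField.complexConj L) hσδ hδ) (0, x.1 0),
              quadraticInfiniteAdeleEquiv (Fp L) L (not_mem_range_algebraMap_of_apply_eq_neg L (IsCMField.complexConj L) hσδ hδ) (x.1 1, x.1 2)), x.2) ∂μ) *
            (∏' v : {v : HeightOneSpectrum (𝓞 (Fp L)) // v ∉ T'},
              innerSectionLoc L v.1 (νY v.1) (νT v.1) (psiLoc L Ψ v.1) (LambdaLoc L e dV hdV dW hdW v.1 χ s)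
                (evalPlace (Fp L) L (IsCMField.complexConj L) (2 + 2) (hermD L e dV hdV dW hdW) v.1 (finPart (Fp L) L (IsCMField.complexConj L) (2 + 2) (hermD L e dV hdV dW hdW) h)) 1) *
            ∏ᶠ v : {v : HeightOneSpectrum (𝓞 (Fp L)) // v ∉ T'},
              LambdaLoc L (Equiv.prodUnique (Fin 1) (Fin 1)) (fun _ => (1 : L)) (fun _ => map_one _) (fun _ => (1 : L)) (fun _ => map_one _) v.1 χ (s - 1 / 2)
                (localCongr L (IsCMField.complexConj L) S one_ne_zero ((formCongr_bridge L S hS).trans (antidiagOne_eq_over L 2)) v.1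
                  (evalPlace (Fp L) L (IsCMField.complexConj L) 2 ((StdForm.antidiagonal 2).over L) v.1
                    (finPart (Fp L) L (IsCMField.complexConj L) 2 ((StdForm.antidiagonal 2).over L) g₂))) := by
  classical
  haveI : Algebra.IsQuadraticExtension (Fp L) L := IsCMField.isQuadraticExtension L
  obtain ⟨μ, hμH, hσf, hμ⟩ := exists_natural_integral_eq_mul_tprod L hσδ hδ Y hY μY μT T' νY νT h2 hδv hν1
  obtain ⟨gN, hgN1, hgN2⟩ := exists_tensor L Ψ SA hΨ hσδ hδ Y hY T' fT h
  refine ⟨μ, gN, hμH, hσf, hgN2, fun s g₂ hFi hlaw => ?_⟩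
  have hc1 := (formCongr_bridge L S hS).trans (antidiagOne_eq_over L 2)
  -- the finite exceptional set `S₀ = {v ∉ T′ : (g₂)_v ∉ U(J₂)(𝒪_v)}`
  have hfin : {v : {v : HeightOneSpectrum (𝓞 (Fp L)) // v ∉ T'} |
      evalPlace (Fp L) L (IsCMField.complexConj L) 2 ((StdForm.antidiagonal 2).over L) v.1
          (finPart (Fp L) L (IsCMField.complexConj L) 2 ((StdForm.antidiagonal 2).over L) g₂) ∉
        localInt L (IsCMField.complexConj L) 2 ((StdForm.antidiagonal 2).over L) v.1}.Finite :=
    (Filter.eventually_cofinite.1 (eventually_evalPlace_mem_localInt (Fp L) L (IsCMField.complexConj L) 2 ((StdForm.antidiagonal 2).over L)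
      (finPart (Fp L) L (IsCMField.complexConj L) 2 ((StdForm.antidiagonal 2).over L) g₂))).preimage Subtype.val_injective.injOn
  have hgood : ∀ v : {v : HeightOneSpectrum (𝓞 (Fp L)) // v ∉ T'}, v ∉ hfin.toFinset →
      evalPlace (Fp L) L (IsCMField.complexConj L) 2 ((StdForm.antidiagonal 2).over L) v.1
          (finPart (Fp L) L (IsCMField.complexConj L) 2 ((StdForm.antidiagonal 2).over L) g₂) ∈
        localInt L (IsCMField.complexConj L) 2 ((StdForm.antidiagonal 2).over L) v.1 := fun v hv => by
    by_contra hg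
    exact hv (hfin.mem_toFinset.2 hg)
  -- ★ E-D0 at the natural shape of ★ E-3a
  have key := hμ (fun q : ↥Y × AdeleRing (𝓞 L) L =>
      f s (Ψ (jAdelic L 4 (weylXi (AdeleRing (𝓞 L) L) (conjAdele (Fp L) L (IsCMField.complexConj L)))) *
        Ψ (jAdelic L 4 (nKlingen (AdeleRing (𝓞 L) L) (conjAdele (Fp L) L (IsCMField.complexConj L)) (conjAdele_conjAdele' L)
          (((q.1 : ↥Y) : AdeleRing (𝓞 L) L)) ((hY _).1 q.1.2) 0 q.2)) *
        (Ψ (jAdelic L 4 (klingenLevi (AdeleRing (𝓞 L) L) (conjAdele (Fp L) L (IsCMField.complexConj L)) (conjAdele_conjAdele' L) 1 ((jAdelic L 2).symm g₂))) * h)))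
    (gN s g₂)
    (fun (v : {v : HeightOneSpectrum (𝓞 (Fp L)) // v ∉ T'}) (p : ↥(skewLoc L v.1) × LocalRing L v.1) =>
      LambdaLoc L e dV hdV dW hdW v.1 χ s
        (psiLoc L Ψ v.1
            (weylXiLoc L v.1 * nKlingenLoc L v.1 (p.1 : LocalRing L v.1) p.1.2 0 p.2 *
              klingenLeviLoc L v.1 1 (evalPlace (Fp L) L (IsCMField.complexConj L) 2 ((StdForm.antidiagonal 2).over L) v.1
                (finPart (Fp L) L (IsCMField.complexConj L) 2 ((StdForm.antidiagonal 2).over L) g₂))) *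
          evalPlace (Fp L) L (IsCMField.complexConj L) (2 + 2) (hermD L e dV hdV dW hdW) v.1
            (finPart (Fp L) L (IsCMField.complexConj L) (2 + 2) (hermD L e dV hdV dW hdW) h)))
    hfin.toFinset hFi
    (fun v hv q hq1 hq2 => local_factor_eq_one L e dV hdV dW hdW v.1 (psiLoc L Ψ v.1) (hΨK v.1 v.2) χ s (hχ v.1 v.2) (hh v.1 v.2) (hgood v hv) q.1.2
      (fun w => mem_integer_of_mem_adicCompletionIntegers L w.1 (hq1 w)) (fun w => mem_integer_of_mem_adicCompletionIntegers L w.1 (hq2 w)))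
    (fun q => integrand_eq_tensor_mul_finprod L Ψ SA hΨ hσδ hδ Y hY T' fT h χ f hfac gN s g₂ (hgN1 s g₂) q)
  -- `hK` (★) and `hJ` (★ C §5) at every `v ∉ T′`
  have hK := fun v : {v : HeightOneSpectrum (𝓞 (Fp L)) // v ∉ T'} =>
    innerSectionLoc_lambdaLoc_mul_localInt L v.1 (νY v.1) (νT v.1) e dV hdV dW hdW (psiLoc L Ψ v.1) (hΨK v.1 v.2) χ s (hχ v.1 v.2) (hh v.1 v.2)
  have hJ := fun (v : {v : HeightOneSpectrum (𝓞 (Fp L)) // v ∉ T'}) (x : localPi L (IsCMField.complexConj L) 2 ((StdForm.antidiagonal 2).over L) v.1) =>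
    apply_eq_apply_one_mul_lambdaLoc_localCongr L v.1 S hS hS' hc1 χ (s - 1 / 2) (hχ v.1 v.2) (h2w v.1 v.2) (hlaw v.1 v.2) (hK v) x
  -- finiteness of the line factors away from `1`
  have hΛfin : (Function.mulSupport fun v : {v : HeightOneSpectrum (𝓞 (Fp L)) // v ∉ T'} =>
      LambdaLoc L (Equiv.prodUnique (Fin 1) (Fin 1)) (fun _ => (1 : L)) (fun _ => map_one _) (fun _ => (1 : L)) (fun _ => map_one _) v.1 χ (s - 1 / 2)
        (localCongr L (IsCMField.complexConj L) S one_ne_zero hc1 v.1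
          (evalPlace (Fp L) L (IsCMField.complexConj L) 2 ((StdForm.antidiagonal 2).over L) v.1
            (finPart (Fp L) L (IsCMField.complexConj L) 2 ((StdForm.antidiagonal 2).over L) g₂)))).Finite := by
    refine hfin.subset fun v hv => ?_
    rw [Function.mem_mulSupport] at hv
    rw [Set.mem_setOf_eq]
    intro hg
    refine hv (lambdaLoc_of_mem_localInt L _ _ _ _ _ v.1 χ (s - 1 / 2) (hχ v.1 v.2) ?_)
    refine (symm_apply_mem_localInt_iff L v.1 S hS hS' (localCongr L (IsCMField.complexConj L) S one_ne_zero hc1 v.1)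
      (localCongr_apply_eq_conj L v.1 S hc1) _ (h2w v.1 v.2)).1 ?_
    rwa [ContinuousMulEquiv.symm_apply_apply]
  by_cases hae : (fun x : (Fin 3 → InfiniteAdeleRing (Fp L)) × (Π v : T', Fin 3 → v.1.adicCompletion (Fp L)) =>
      gN s g₂ ((quadraticInfiniteAdeleEquiv (Fp L) L (not_mem_range_algebraMap_of_apply_eq_neg L (IsCMField.complexConj L) hσδ hδ) (0, x.1 0),
        quadraticInfiniteAdeleEquiv (Fp L) L (not_mem_range_algebraMap_of_apply_eq_neg L (IsCMField.complexConj L) hσδ hδ) (x.1 1, x.1 2)), x.2)) =ᵐ[μ] 0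
  · -- the `T′`-tensor is a.e. zero: both sides vanish
    rw [key.1, integral_eq_zero_of_ae hae]
    simp only [zero_mul]
  · -- `c_v = J_{s,v}(1)` is multipliable: `J_{s,v}((g₂)_v)` is (★ E-D0) and `Λ^{line} ≠ 0`
    have hm : Multipliable fun v : {v : HeightOneSpectrum (𝓞 (Fp L)) // v ∉ T'} =>
        innerSectionLoc L v.1 (νY v.1) (νT v.1) (psiLoc L Ψ v.1) (LambdaLoc L e dV hdV dW hdW v.1 χ s)
          (evalPlace (Fp L) L (IsCMField.complexConj L) (2 + 2) (hermD L e dV hdV dW hdW) v.1 (finPart (Fp L) L (IsCMField.complexConj L) (2 + 2) (hermD L e dV hdV dW hdW) h))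
          (evalPlace (Fp L) L (IsCMField.complexConj L) 2 ((StdForm.antidiagonal 2).over L) v.1
            (finPart (Fp L) L (IsCMField.complexConj L) 2 ((StdForm.antidiagonal 2).over L) g₂)) := key.2 hae
    have hne := fun v : {v : HeightOneSpectrum (𝓞 (Fp L)) // v ∉ T'} => lambdaLoc_line_ne_zero L v.1 χ (s - 1 / 2) (hχ v.1 v.2) (h2w v.1 v.2)
      (localCongr L (IsCMField.complexConj L) S one_ne_zero hc1 v.1
        (evalPlace (Fp L) L (IsCMField.complexConj L) 2 ((StdForm.antidiagonal 2).over L) v.1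
          (finPart (Fp L) L (IsCMField.complexConj L) 2 ((StdForm.antidiagonal 2).over L) g₂)))
    have hΛinv : (Function.mulSupport fun v : {v : HeightOneSpectrum (𝓞 (Fp L)) // v ∉ T'} =>
        (LambdaLoc L (Equiv.prodUnique (Fin 1) (Fin 1)) (fun _ => (1 : L)) (fun _ => map_one _) (fun _ => (1 : L)) (fun _ => map_one _) v.1 χ (s - 1 / 2)
          (localCongr L (IsCMField.complexConj L) S one_ne_zero hc1 v.1
            (evalPlace (Fp L) L (IsCMField.complexConj L) 2 ((StdForm.antidiagonal 2).over L) v.1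
              (finPart (Fp L) L (IsCMField.complexConj L) 2 ((StdForm.antidiagonal 2).over L) g₂))))⁻¹).Finite := by
      rw [Function.mulSupport_fun_inv]; exact hΛfin
    have hc : Multipliable fun v : {v : HeightOneSpectrum (𝓞 (Fp L)) // v ∉ T'} =>
        innerSectionLoc L v.1 (νY v.1) (νT v.1) (psiLoc L Ψ v.1) (LambdaLoc L e dV hdV dW hdW v.1 χ s)
          (evalPlace (Fp L) L (IsCMField.complexConj L) (2 + 2) (hermD L e dV hdV dW hdW) v.1 (finPart (Fp L) L (IsCMField.complexConj L) (2 + 2) (hermD L e dV hdV dW hdW) h)) 1 := by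
      refine (hm.mul (multipliable_of_hasFiniteMulSupport hΛinv)).congr fun v => ?_
      rw [hJ v, mul_inv_cancel_right₀ (hne v)]
    exact innerSection_eq_mul_tprod_mul_finprod L T' νY νT (fun v => psiLoc L Ψ v) χ s (s - 1 / 2)
      (fun v => evalPlace (Fp L) L (IsCMField.complexConj L) (2 + 2) (hermD L e dV hdV dW hdW) v (finPart (Fp L) L (IsCMField.complexConj L) (2 + 2) (hermD L e dV hdV dW hdW) h))
      (fun v => evalPlace (Fp L) L (IsCMField.complexConj L) 2 ((StdForm.antidiagonal 2).over L) v (finPart (Fp L) L (IsCMField.complexConj L) 2 ((StdForm.antidiagonal 2).over L) g₂))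
      _ _ key.1 (fun v => (localCongr L (IsCMField.complexConj L) S one_ne_zero hc1 v : _ → _)) _ hc hJ hΛfin

end Euler

end Summit.HodgeConjecture.HodgeConjecture.Cruxes.HLiu418.K2LiuKlingenInnerSectionEulerIdentity

end
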